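import Summits.BirchSwinnertonDyer.Rank1Residual.F1Sign2.HondaSystemAtTwo
import Summits.BirchSwinnertonDyer.BirchSwinnertonDyer.Theorems.ThetaPartnerAtTwoSignedKatoUpToAtTwoLocalTwoSignedIntersection
import Literature.NumberTheory.EllipticCurves.Sprung2012.HondaLevelTwoRelationsProofs
import Literature.Algebra.Module.PadicFunctionalSeparation
import HarnessLib

/-!
# Route `ByReductionTypeAtTwo` (rung K4), crux `SupersingularRankZeroAtTwo` (item stmt-BirchSwinnertonDyer-19097):
# **(Y) FIRST-LAYER TWIST DETECTION AT TWO** — the first-layer arithmetic half of CDF±_H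
# (line `Cruxes/SupersingularRankZeroAtTwo/Lines/odd_blind_package.lean` v2.6.1, 18db34093d095bfe, slot 5 `stub_CD`,
# local conjunct `FlatBlindLocalTransversalityOffZeroAtTwo` at `a₂ = ±2`, Honda rung; -imc D-imc-72 sub-target (Y)
# `D72BlindGenerator.FirstLayerTwistDetectionAtTwo`) — seat `bsd-2adic-ss-1`, GEN 19, LEAD attack (L3)

HONEST FRAMING (cell `bsd-2adic`, run/shared/lean/pub/bsd-2adic/): THEOREMS ONLY; no definition, no named fact, no
`sorry`, no instance. Nothing about any Selmer group, `L`-function or census cell is asserted; nothing booked (D-0054);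
BSD is not proved by any of this. PARTITION: X5@2 good-ss r₀ block, `a₂ = ±2` sub-rows × p = 2 — types-the-object-of
(the first-layer half (Y) of the Honda rung CDF±_H of CDF± becomes a kernel theorem); closes none. bears_on: K4 (item 19097).

## Statement

`OddBlindLocal.firstLayerTwistDetectionAtTwo` has, verbatim, the body of -imc's typed sub-target
`D72BlindGenerator.FirstLayerTwistDetectionAtTwo` (`Cruxes/SupersingularRankZeroAtTwo/D72BlindGenerator.lean`, commit
caa7a057f3a7; a `Cruxes/` workfile is not importable, so the body is restated and the two are definitionally equal): for
`W/ℚ` globally minimal with `GoodSS W 2` (and `a₂ ≠ 0`, unused), `κ` cyclotomic (unused), `v ∋ 2`, `g` a local lift of the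
topological generator, `c` with `c n ∈ E(ℚ_{n,v})` that is the `c`-part of a HONDA SYSTEM AT TWO
(`F1Sign2.IsHondaSystemAtTwo κ ι W a₂ g c₋ c`), EVERY additive `z : E(ℚ_{∞,v}) → ℤ₂` with `z(g·c₁) − z(c₁) = −2` detects every
`ψ₂`-vector of the first layer to the exponent of the line's INDEX form: `y ∈ E(ℚ_{1,v})`, `g·y = −y`, `y ∉ 2^k·E(ℚ_{1,v})` ⟹
`2^{k+1} ∤ z(y)`.  In fact the SHARP exponent holds: `2^k ∤ z(y)` (`not_pow_dvd_apply_of_isHondaSystemAtTwo`), matching the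
model's «exponent 0» (MEMO-imc §10.111: `w_T(y₀) = 1`).

## Proof (generic base `K`, any `a`; only three Honda clauses are used)

Write `M = E(K_1·K_v)` (layer `1`), `ε = c₋ ∈ E(K_v)`, `Y = M^{g = −1}`.
1. THE EXPLICIT ψ₂-GENERATOR.  The two bottom relations `c₀ = (a² − 2a − 1)·ε`, `Tr_{1/0} c₁ = a·c₀ + (4 − 2a)·ε` and
   `Tr_{1/0} c₁ = c₁ + g·c₁` give `c₁ + g·c₁ = λ·ε` with `λ = a³ − 2a² − 3a + 4`, which is EVEN for every integer `a`
   (`a(a+1)` is even).  Put `s = (λ/2)·ε` (fixed by `g`) and `y₀ = c₁ − s`: then `g·y₀ = −y₀` and `(g − 1)c₁ = −2·y₀`.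
   Hence `z(g·c₁) − z(c₁) = −2` reads `z(y₀) = 1`.
2. `Y` IS DUALLY CYCLIC ON `y₀` (`apply_eq_zero_of_apply_twistGenerator_eq_zero`): an additive `η : M → ℤ₂` with `η(y₀) = 0`
   kills `Y`.  Indeed `η' := η ∘ (1 − g)` kills `c₁`, `g·c₁` (their images are `±2y₀`) and `c₀` (fixed by `g`), so both orbit
   sums `P_{1,c₁}(η')`, `P_{1,c₀}(η')` VANISH and Sprung's level-`1` generation clause (dual form, `inj₁` of
   `IsHondaSystemAtTwo`) gives `η' = 0`; for `y ∈ Y`, `0 = η'(y) = η(2y) = 2η(y)`.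
3. SEPARATION.  `M` has no `2`-torsion (hypothesis (NT); over `ℚ` at `v ∋ 2` it is the tree's
   `SignedIntersection.noTwoTorsion_localTowerPointsOfEmb_adicCompletion`), so `y ∉ 2^k·M` yields an additive `u : M → ℤ₂`
   with `2^k ∤ u(y)` (`Literature.Algebra.Module.exists_addMonoidHom_padicInt_not_dvd`).  Apply step 2 to
   `η = u − u(y₀)·z|_M`: `u(y) = u(y₀)·z(y)`, so `2^k ∣ z(y)` is impossible.
No Coleman theory, no formal group, no `a₂ ≠ 0`; not in print at `p = 2` (Sprung 2012 Thm. 2.2 / Kobayashi 2003 Prop. 8.12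
are the odd-`p` shape of the generation clause used in step 2).

## References
* [Sprung2012] F. Sprung, J. Number Theory 132 (2012): Thm. 2.2 (generation clause, relations (1)(2), p. 1487), Def. 3.1
  (orbit sums `P_{n,x}`, p. 1489), Def. 7.9 (p. 1503).
* [Kobayashi2003] S. Kobayashi, Invent. Math. 152 (2003): Prop. 8.12 (pp. 17–18).
* [NeukirchSchmidtWingberg2008] I §1 (1.1.8) (Pontryagin duality; separation).
* Tree: `F1Sign2/HondaSystemAtTwo.lean` (`IsHondaSystemAtTwo`), `Sprung2012/{LocalTowerTraceProofs, HondaLevelTwoRelationsProofs,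
  ColemanMapLambdaActionProofs}.lean`, `Literature/Algebra/Module/PadicFunctionalSeparation.lean`,
  `Cruxes/SupersingularRankZeroAtTwo/D72BlindGenerator.lean` ((G) ∧ (Y) ⟹ CDF±_H, -imc g29).
-/

set_option autoImplicit false
set_option linter.dupNamespace false

noncomputable section

open scoped Classical NumberField

universe u

namespace Summit.BirchSwinnertonDyer.BirchSwinnertonDyer.Theorems

namespace OddBlindLocal

open NumberField IsDedekindDomain Literature.NumberTheory.EllipticCurves Literature.NumberTheory.GaloisRepresentations
  ZpExtension Literature.NumberTheory.EllipticCurves.Kobayashi2003 Literature.NumberTheory.EllipticCurves.Sprung2017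
  Literature.NumberTheory.EllipticCurves.Sprung2012 Literature.NumberTheory.EllipticCurves.Rank1Residual
  Summit.BirchSwinnertonDyer.Rank1Residual.F1Sign2

/-! ## §1 Generic base: the explicit `ψ₂`-generator of a Honda system at two and the dual cyclicity of `E(K_1·K_v)^{g=−1}` -/

section Generic

variable {K : Type u} [Field K] {κ : ZpExtension K 2}
variable {E : Type u} [Field E] [Algebra K E] {ι : AlgebraicClosure K →ₐ[K] AlgebraicClosure E}
variable {W : WeierstrassCurve K}

/-- `a³ − 2a² − 3a + 4` is even for every integer `a` (`a(a+1)` is even). [folklore] -/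
theorem exists_two_mul_eq_hondaTraceCoeff (a : ℤ) : ∃ m : ℤ, 2 * m = a * (a ^ 2 - 2 * a - 1) + (4 - 2 * a) := by
  obtain ⟨r, hr⟩ := Int.even_mul_succ_self a
  exact ⟨(a - 1) * r - (a ^ 2 + a - 2), by linear_combination (1 - a) * hr⟩

/-- **THE EXPLICIT `ψ₂`-GENERATOR of a Honda system at two.**  For a Honda system `(c₋, c)` at `2` with parameter `a` and a
local lift `g` of the topological generator there is a point `s ∈ E(K_v)` (namely `s = ½(a³ − 2a² − 3a + 4)·c₋`) such that
`y₀ := c₁ − s` satisfies `g·y₀ = −y₀` and `g·c₁ − c₁ = −2·y₀`: the bottom relations `c₀ = (a² − 2a − 1)c₋`,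
`Tr_{1/0}c₁ = a·c₀ + (4 − 2a)c₋` with `Tr_{1/0}c₁ = c₁ + g·c₁`. [cite: Sprung2012, Thm. 2.2 (1)–(2) (p. 1487)] -/
theorem exists_twistGenerator_of_isHondaSystemAtTwo {a : ℤ} {g : Field.absoluteGaloisGroup E}
    (hg : κ.IsTopGenerator (resGalOfEmb ι g)) {cneg : localPoints W E} {c : ℕ → localPoints W E}
    (hH : IsHondaSystemAtTwo κ ι W a g cneg c) :
    ∃ s ∈ localLayerPointsOfEmb κ ι W 0,
      g • (c 1 - s) = -(c 1 - s) ∧ g • c 1 - c 1 = -(2 • (c 1 - s)) := by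
  obtain ⟨hcneg, hcn, hc0, htr1, -⟩ := hH
  obtain ⟨m, hm⟩ := exists_two_mul_eq_hondaTraceCoeff a
  -- `Tr_{1/0} c₁ = c₁ + g • c₁`
  have htr : localTraceOfEmb κ ι W 0 1 (c 1) = c 1 + g • c 1 := by
    rw [localTraceOfEmb_succ_eq_sum_pow_smul κ ι W hg 0 (hcn 1)]
    simp only [Finset.sum_range_succ, Finset.sum_range_zero, zero_add, pow_zero, one_mul, pow_one, one_smul]
  -- `c₁ + g • c₁ = (2m) • c₋`
  have hsum : c 1 + g • c 1 = (2 * m) • cneg := by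
    rw [← htr, htr1, hc0, smul_smul, ← add_smul, hm]
  refine ⟨m • cneg, AddSubgroup.zsmul_mem _ hcneg m, ?_, ?_⟩
  · have hfix : g • (m • cneg) = m • cneg :=
      (mem_localLayerPointsOfEmb_zero_iff κ ι W _).mp (AddSubgroup.zsmul_mem _ hcneg m) g
    have e : g • c 1 = (2 * m) • cneg - c 1 := by rw [← hsum]; abel
    rw [smul_sub, hfix, e, mul_smul, two_zsmul]
    abel
  · have e : g • c 1 = (2 * m) • cneg - c 1 := by rw [← hsum]; abel
    rw [e, mul_smul, two_zsmul, two_nsmul]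
    abel

/-- **DUAL CYCLICITY OF `E(K_1·K_v)^{g=−1}` ON THE `ψ₂`-GENERATOR.**  Let `(c₋, c)` be a Honda system at two, `g` a local lift of
the topological generator and `y₀ = c₁ − s` as in `exists_twistGenerator_of_isHondaSystemAtTwo` (any `s ∈ E(K_v)` with
`g·c₁ − c₁ = −2·(c₁ − s)`).  Then every additive `η : E(K_1·K_v) → ℤ₂` with `η(y₀) = 0` vanishes on every `y ∈ E(K_1·K_v)` with
`g·y = −y`.  Proof: `η ∘ (1 − g)` kills the `g`-orbits of `c₁` (images `±2y₀`) and of `c₀` (fixed), so Sprung's level-one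
generation clause in dual form (`IsHondaSystemAtTwo`, clause `inj₁`: a functional whose orbit sums against `c₁` and `c₀`
vanish modulo `ω₁` is zero) forces `η ∘ (1 − g) = 0`; and `(1 − g)y = 2y`. [cite: Sprung2012, Thm. 2.2 (generation clause, p. 1487) and Cor. 2.10 (p. 1489)]
[cite: Kobayashi2003, Prop. 8.12 (pp. 17–18)] -/
theorem apply_eq_zero_of_apply_twistGenerator_eq_zero {a : ℤ} {g : Field.absoluteGaloisGroup E}
    (hg : κ.IsTopGenerator (resGalOfEmb ι g)) {cneg : localPoints W E} {c : ℕ → localPoints W E}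
    (hH : IsHondaSystemAtTwo κ ι W a g cneg c)
    {s : localPoints W E} (hs : s ∈ localLayerPointsOfEmb κ ι W 0) (hgen : g • c 1 - c 1 = -(2 • (c 1 - s)))
    (η : localLayerPointsOfEmb κ ι W 1 →+ ℤ_[2])
    (hη : η ⟨c 1 - s, sub_mem (hH.2.1 1) (localLayerPointsOfEmb_mono κ ι W (Nat.zero_le 1) hs)⟩ = 0)
    {y : localPoints W E} (hy : y ∈ localLayerPointsOfEmb κ ι W 1) (hgy : g • y = -y) :
    η ⟨y, hy⟩ = 0 := by
  have hcneg := hH.1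
  have hcn := hH.2.1
  have hc0 := hH.2.2.1
  have hinj := hH.2.2.2.2.2.2.2.1
  have h01 : localLayerPointsOfEmb κ ι W 0 ≤ localLayerPointsOfEmb κ ι W 1 :=
    localLayerPointsOfEmb_mono κ ι W (Nat.zero_le 1)
  have hc1 : c 1 ∈ (localLayerPointsOfEmb κ ι W 1) := hcn 1
  have hy₀ : c 1 - s ∈ (localLayerPointsOfEmb κ ι W 1) := sub_mem hc1 (h01 hs)
  have hc0mem : c 0 ∈ localLayerPointsOfEmb κ ι W 0 := by rw [hc0]; exact AddSubgroup.zsmul_mem _ hcneg _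
  -- the functional `η' = η ∘ (1 − g)` on `(localLayerPointsOfEmb κ ι W 1)`
  let D : (localLayerPointsOfEmb κ ι W 1) →+ localPoints W E := (localLayerPointsOfEmb κ ι W 1).subtype - (DistribSMul.toAddMonoidHom (localPoints W E) g).comp (localLayerPointsOfEmb κ ι W 1).subtype
  have hD : ∀ x : (localLayerPointsOfEmb κ ι W 1), D x = (x : localPoints W E) - g • (x : localPoints W E) := fun x ↦ rfl
  have hDmem : ∀ x : (localLayerPointsOfEmb κ ι W 1), D x ∈ (localLayerPointsOfEmb κ ι W 1) := fun x ↦ by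
    rw [hD]; exact sub_mem x.2 (smul_mem_localLayerPointsOfEmb κ ι W 1 g x.2)
  let η' : (localLayerPointsOfEmb κ ι W 1) →+ ℤ_[2] := η.comp (D.codRestrict (localLayerPointsOfEmb κ ι W 1) hDmem)
  have hη' : ∀ (x : localPoints W E) (hx : x ∈ (localLayerPointsOfEmb κ ι W 1)),
      η' ⟨x, hx⟩ = η ⟨x - g • x, hDmem ⟨x, hx⟩⟩ := fun x hx ↦ rfl
  -- `η` kills `±2y₀`, hence `η'` kills the orbit of `c₁`
  have h2y₀ : η ⟨2 • (c 1 - s), AddSubgroup.nsmul_mem _ hy₀ 2⟩ = 0 := by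
    have e : (⟨2 • (c 1 - s), AddSubgroup.nsmul_mem _ hy₀ 2⟩ : (localLayerPointsOfEmb κ ι W 1)) = 2 • ⟨c 1 - s, hy₀⟩ := rfl
    rw [e, map_nsmul, hη, smul_zero]
  have hg2 : g ^ 2 • c 1 = c 1 := by
    have h := pow_mul_smul_of_mem_localLayerPointsOfEmb κ ι W hg hc1 1
    rwa [pow_one, mul_one] at h
  have horb1 : ∀ j : ℕ, η' ⟨g ^ j • c 1, smul_mem_localLayerPointsOfEmb κ ι W 1 _ hc1⟩ = 0 := by
    intro j
    rw [hη']
    rcases Nat.mod_two_eq_zero_or_one j with hj | hj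
    · have e1 : g ^ j • c 1 = c 1 := by rw [pow_smul_eq_pow_mod_smul_of_mem_layer_one hg hc1 j, hj, pow_zero, one_smul]
      have e : (⟨g ^ j • c 1 - g • (g ^ j • c 1), hDmem ⟨_, smul_mem_localLayerPointsOfEmb κ ι W 1 _ hc1⟩⟩ : (localLayerPointsOfEmb κ ι W 1)) =
          ⟨2 • (c 1 - s), AddSubgroup.nsmul_mem _ hy₀ 2⟩ := by
        apply Subtype.ext
        simp only [e1]
        have : c 1 - g • c 1 = -(g • c 1 - c 1) := by abel
        rw [this, hgen, neg_neg]
      rw [e, h2y₀]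
    · have e1 : g ^ j • c 1 = g • c 1 := by rw [pow_smul_eq_pow_mod_smul_of_mem_layer_one hg hc1 j, hj, pow_one]
      have e2 : g • (g • c 1) = c 1 := by rw [smul_smul, ← sq, hg2]
      have e : (⟨g ^ j • c 1 - g • (g ^ j • c 1), hDmem ⟨_, smul_mem_localLayerPointsOfEmb κ ι W 1 _ hc1⟩⟩ : (localLayerPointsOfEmb κ ι W 1)) =
          -⟨2 • (c 1 - s), AddSubgroup.nsmul_mem _ hy₀ 2⟩ := by
        apply Subtype.ext
        simp only [e1, e2, AddSubgroup.coe_neg]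
        rw [hgen]
      rw [e, map_neg, h2y₀, neg_zero]
  -- `η'` kills the orbit of `c₀` (fixed by `g`)
  have horb0 : ∀ j : ℕ, η' ⟨g ^ j • c 0, smul_mem_localLayerPointsOfEmb κ ι W 1 _ (h01 hc0mem)⟩ = 0 := by
    intro j
    rw [hη']
    have e1 : g ^ j • c 0 = c 0 := (mem_localLayerPointsOfEmb_zero_iff κ ι W _).mp hc0mem (g ^ j)
    have e2 : g • c 0 = c 0 := (mem_localLayerPointsOfEmb_zero_iff κ ι W _).mp hc0mem g
    have e : (⟨g ^ j • c 0 - g • (g ^ j • c 0), hDmem ⟨_, smul_mem_localLayerPointsOfEmb κ ι W 1 _ (h01 hc0mem)⟩⟩ : (localLayerPointsOfEmb κ ι W 1)) =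
        0 := by
      apply Subtype.ext
      simp only [e1, e2, sub_self, AddSubgroup.coe_zero]
    rw [e, map_zero]
  -- both orbit sums of `η'` vanish, so `η' = 0` by the generation clause
  have hsum : ∀ (x : localPoints W E) (hx : x ∈ (localLayerPointsOfEmb κ ι W 1)),
      (∀ j : ℕ, η' ⟨g ^ j • x, smul_mem_localLayerPointsOfEmb κ ι W 1 _ hx⟩ = 0) → pairingSum W (localLayerPointsOfEmb κ ι W 1) g 1 x η' = 0 := by
    intro x hx h
    rw [pairingSum_def]
    refine Finset.sum_eq_zero fun j _ ↦ ?_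
    rw [evalOn_of_mem W (localLayerPointsOfEmb κ ι W 1) η' (smul_mem_localLayerPointsOfEmb κ ι W 1 _ hx), h j, map_zero, zero_mul]
  have hη'0 : η' = 0 := by
    refine hinj 1 le_rfl η' ?_ ?_
    · rw [hsum (c 1) hc1 horb1]; exact dvd_zero _
    · rw [Nat.sub_self, hsum (c 0) (h01 hc0mem) horb0]; exact dvd_zero _
  -- `0 = η'(y) = η(y − g•y) = 2 η(y)`
  have h := hη' y hy
  rw [hη'0, AddMonoidHom.zero_apply] at h
  have e : (⟨y - g • y, hDmem ⟨y, hy⟩⟩ : (localLayerPointsOfEmb κ ι W 1)) = 2 • ⟨y, hy⟩ := by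
    apply Subtype.ext
    change y - g • y = 2 • y
    rw [hgy, two_nsmul, sub_neg_eq_add]
  rw [e, map_nsmul, eq_comm, smul_eq_zero] at h
  exact h.resolve_left two_ne_zero

/-- ★ **(Y), SHARP FORM, generic base.**  (NT) `E(K_∞·K_v)` has no `2`-torsion; `(c₋, c)` a Honda system at two for `(a, g)`,
`g` a local lift of the topological generator; `z : E(K_∞·K_v) → ℤ₂` additive with `z(g·c₁) − z(c₁) = −2`.  Then for every
`y ∈ E(K_1·K_v)` with `g·y = −y` and `y ∉ 2^k·E(K_1·K_v)`: **`2^k ∤ z(y)`**.  (Step 1: `z(y₀) = 1`; step 3: a separating `u`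
with `2^k ∤ u(y)`; step 2 applied to `u − u(y₀)·z|_M` gives `u(y) = u(y₀)z(y)`.)
[cite: Sprung2012, Thm. 2.2 (p. 1487) and Def. 7.9 (p. 1503)] [cite: NeukirchSchmidtWingberg2008, I §1 (1.1.8)] -/
theorem not_pow_dvd_apply_of_isHondaSystemAtTwo
    (hnt : ∀ P ∈ localTowerPointsOfEmb κ ι W, 2 • P = 0 → P = 0)
    {a : ℤ} {g : Field.absoluteGaloisGroup E} (hg : κ.IsTopGenerator (resGalOfEmb ι g))
    {cneg : localPoints W E} {c : ℕ → localPoints W E} (hH : IsHondaSystemAtTwo κ ι W a g cneg c)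
    (z : localTowerPointsOfEmb κ ι W →+ ℤ_[2])
    (hz : z ⟨g • c 1, smul_mem_localTowerPointsOfEmb κ ι W g
        (localLayerPointsOfEmb_le_localTowerPointsOfEmb κ ι W 1 (hH.2.1 1))⟩ -
      z ⟨c 1, localLayerPointsOfEmb_le_localTowerPointsOfEmb κ ι W 1 (hH.2.1 1)⟩ = -2)
    {y : localPoints W E} (hy : y ∈ localLayerPointsOfEmb κ ι W 1) (hgy : g • y = -y)
    {k : ℕ} (hndiv : ∀ w ∈ localLayerPointsOfEmb κ ι W 1, 2 ^ k • w ≠ y) :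
    ¬ (2 : ℤ_[2]) ^ k ∣ z ⟨y, localLayerPointsOfEmb_le_localTowerPointsOfEmb κ ι W 1 hy⟩ := by
  have hle : localLayerPointsOfEmb κ ι W 1 ≤ localTowerPointsOfEmb κ ι W :=
    localLayerPointsOfEmb_le_localTowerPointsOfEmb κ ι W 1
  have hc1 : c 1 ∈ (localLayerPointsOfEmb κ ι W 1) := hH.2.1 1
  -- step 1: the generator `y₀ = c₁ − s` with `z(y₀) = 1`
  obtain ⟨s, hs, hgy₀, hgen⟩ := exists_twistGenerator_of_isHondaSystemAtTwo hg hH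
  have hy₀ : c 1 - s ∈ (localLayerPointsOfEmb κ ι W 1) := sub_mem hc1 (localLayerPointsOfEmb_mono κ ι W (Nat.zero_le 1) hs)
  let ζ : (localLayerPointsOfEmb κ ι W 1) →+ ℤ_[2] := z.comp (AddSubgroup.inclusion hle)
  have hζ : ∀ (x : localPoints W E) (hx : x ∈ (localLayerPointsOfEmb κ ι W 1)), ζ ⟨x, hx⟩ = z ⟨x, hle hx⟩ := fun x hx ↦ rfl
  have hζy₀ : ζ ⟨c 1 - s, hy₀⟩ = 1 := by
    rw [hζ]
    have e : (⟨g • c 1, smul_mem_localTowerPointsOfEmb κ ι W g (hle hc1)⟩ : localTowerPointsOfEmb κ ι W) -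
        ⟨c 1, hle hc1⟩ = -(2 • ⟨c 1 - s, hle hy₀⟩) := by
      apply Subtype.ext
      change g • c 1 - c 1 = -(2 • (c 1 - s))
      exact hgen
    have h := hz
    rw [← map_sub, e, map_neg, map_nsmul, neg_inj, nsmul_eq_mul, Nat.cast_ofNat] at h
    have h' : (2 : ℤ_[2]) * z ⟨c 1 - s, hle hy₀⟩ = 2 * 1 := by rw [h, mul_one]
    exact mul_left_cancel₀ two_ne_zero h'
  -- step 3: separation
  have hM2 : ∀ q : (localLayerPointsOfEmb κ ι W 1), 2 • q = 0 → q = 0 := fun q hq ↦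
    Subtype.ext (hnt q (hle q.2) (by rw [← AddSubgroupClass.coe_nsmul, hq, AddSubgroup.coe_zero]))
  have hndivM : ∀ q : (localLayerPointsOfEmb κ ι W 1), 2 ^ k • q ≠ ⟨y, hy⟩ := fun q hq ↦
    hndiv q q.2 (by rw [← AddSubgroupClass.coe_nsmul, hq])
  obtain ⟨u, hu⟩ := Literature.Algebra.Module.exists_addMonoidHom_padicInt_not_dvd (p := 2) hM2 hndivM
  -- step 2 for `η = u − u(y₀)·ζ`
  let η : (localLayerPointsOfEmb κ ι W 1) →+ ℤ_[2] := u - (AddMonoidHom.mulLeft (u ⟨c 1 - s, hy₀⟩)).comp ζ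
  have hηapp : ∀ x : (localLayerPointsOfEmb κ ι W 1), η x = u x - u ⟨c 1 - s, hy₀⟩ * ζ x := fun x ↦ rfl
  have hηy₀ : η ⟨c 1 - s, hy₀⟩ = 0 := by rw [hηapp, hζy₀, mul_one, sub_self]
  have h0 := apply_eq_zero_of_apply_twistGenerator_eq_zero hg hH hs hgen η hηy₀ hy hgy
  rw [hηapp, sub_eq_zero, hζ] at h0
  intro hdvd
  exact hu (by push_cast; rw [h0]; exact Dvd.dvd.mul_left hdvd _)

/-- (Y) in the line's INDEX form (exponent `k + 1`), generic base: a fortiori from the sharp form.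
[cite: Sprung2012, Def. 7.9 (p. 1503)] -/
theorem not_pow_succ_dvd_apply_of_isHondaSystemAtTwo
    (hnt : ∀ P ∈ localTowerPointsOfEmb κ ι W, 2 • P = 0 → P = 0)
    {a : ℤ} {g : Field.absoluteGaloisGroup E} (hg : κ.IsTopGenerator (resGalOfEmb ι g))
    {cneg : localPoints W E} {c : ℕ → localPoints W E} (hH : IsHondaSystemAtTwo κ ι W a g cneg c)
    (z : localTowerPointsOfEmb κ ι W →+ ℤ_[2])
    (hz : z ⟨g • c 1, smul_mem_localTowerPointsOfEmb κ ι W g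
        (localLayerPointsOfEmb_le_localTowerPointsOfEmb κ ι W 1 (hH.2.1 1))⟩ -
      z ⟨c 1, localLayerPointsOfEmb_le_localTowerPointsOfEmb κ ι W 1 (hH.2.1 1)⟩ = -2)
    {y : localPoints W E} (hy : y ∈ localLayerPointsOfEmb κ ι W 1) (hgy : g • y = -y)
    {k : ℕ} (hndiv : ∀ w ∈ localLayerPointsOfEmb κ ι W 1, 2 ^ k • w ≠ y) :
    ¬ (2 : ℤ_[2]) ^ (k + 1) ∣ z ⟨y, localLayerPointsOfEmb_le_localTowerPointsOfEmb κ ι W 1 hy⟩ :=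
  fun h ↦ not_pow_dvd_apply_of_isHondaSystemAtTwo hnt hg hH z hz hy hgy hndiv
    (dvd_trans (pow_dvd_pow 2 (Nat.le_succ k)) h)

end Generic

/-! ## §2 Over `ℚ` at `v ∋ 2`: (Y) `FirstLayerTwistDetectionAtTwo` with the body of -imc's typed sub-target verbatim -/

section Rat

/-- ★★ **(Y) `FirstLayerTwistDetectionAtTwo` IS A THEOREM** — body VERBATIM the one of
`Cruxes.SupersingularRankZeroAtTwo.D72BlindGenerator.FirstLayerTwistDetectionAtTwo` (D-imc-72; so the two are
definitionally equal and `flatBlindLocalTransversalityHondaOffZeroAtTwo_of_generator` consumes this theorem by `exact`): for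
`W/ℚ` globally minimal, good supersingular at `2` (`a₂ ≠ 0` is carried, not used), `κ` cyclotomic, `v ∋ 2`, a local lift `g`
of the topological generator, levels `c n ∈ E(ℚ_{n,v})`, a Honda system at two `(c₋, c)`, EVERY additive `z` on `E(ℚ_{∞,v})` with
`z(g·c₁) − z(c₁) = −2`, every `ψ₂`-vector `y ∈ E(ℚ_{1,v})` and every `k` with `y ∉ 2^k·E(ℚ_{1,v})`: `2^{k+1} ∤ z(y)`.
(NT) is the tree's `SignedIntersection.noTwoTorsion_localTowerPointsOfEmb_adicCompletion`.
[cite: Sprung2012, Thm. 2.2 (p. 1487) and Def. 7.9 (p. 1503)] [cite: Kobayashi2003, Prop. 8.12 (pp. 17–18)] -/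
theorem firstLayerTwistDetectionAtTwo :
    ∀ (W : WeierstrassCurve ℚ) [W.IsElliptic] [W.IsGloballyMinimal],
    GoodSS W 2 → W.frobeniusTrace 2 ≠ 0 →
    ∀ (κ : ZpExtension ℚ 2), κ.IsCyclotomic →
    ∀ (v : HeightOneSpectrum (𝓞 ℚ)), (2 : 𝓞 ℚ) ∈ v.asIdeal →
    ∀ (g : Field.absoluteGaloisGroup (v.adicCompletion ℚ)) (c : ℕ → localPoints W (v.adicCompletion ℚ)),
      κ.IsTopGenerator (resGalOfEmb (closureEmb (K := ℚ) (v.adicCompletion ℚ)) g) →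
      ∀ (hc : ∀ n, c n ∈ localLayerPointsOfEmb κ (closureEmb (K := ℚ) (v.adicCompletion ℚ)) W n),
      (∃ cneg : localPoints W (v.adicCompletion ℚ),
        Summit.BirchSwinnertonDyer.Rank1Residual.F1Sign2.IsHondaSystemAtTwo κ (closureEmb (K := ℚ) (v.adicCompletion ℚ)) W
          (W.frobeniusTrace 2) g cneg c) →
      ∀ z : localTowerPointsOfEmb κ (closureEmb (K := ℚ) (v.adicCompletion ℚ)) W →+ ℤ_[2],
        z ⟨g • c 1, smul_mem_localTowerPointsOfEmb κ (closureEmb (K := ℚ) (v.adicCompletion ℚ)) W g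
            (localLayerPointsOfEmb_le_localTowerPointsOfEmb κ (closureEmb (K := ℚ) (v.adicCompletion ℚ)) W 1 (hc 1))⟩
          - z ⟨c 1, localLayerPointsOfEmb_le_localTowerPointsOfEmb κ (closureEmb (K := ℚ) (v.adicCompletion ℚ)) W 1 (hc 1)⟩
          = -2 →
      ∀ (y : localPoints W (v.adicCompletion ℚ))
        (hy : y ∈ localLayerPointsOfEmb κ (closureEmb (K := ℚ) (v.adicCompletion ℚ)) W 1), g • y = -y →
        ∀ k : ℕ, (∀ w ∈ localLayerPointsOfEmb κ (closureEmb (K := ℚ) (v.adicCompletion ℚ)) W 1, 2 ^ k • w ≠ y) →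
          ¬ (2 : ℤ_[2]) ^ (k + 1) ∣
            z ⟨y, localLayerPointsOfEmb_le_localTowerPointsOfEmb κ (closureEmb (K := ℚ) (v.adicCompletion ℚ)) W 1 hy⟩ := by
  intro W _ _ hss _ha κ _hκ v hv g c hg hc hH z hz y hy hgy k hndiv
  obtain ⟨cneg, hH⟩ := hH
  exact not_pow_succ_dvd_apply_of_isHondaSystemAtTwo
    (SignedKatoOffTwo.SignedIntersection.noTwoTorsion_localTowerPointsOfEmb_adicCompletion W hss κ v hv _)
    hg hH z hz hy hgy hndiv

/-- **(Y), SHARP EXPONENT, over `ℚ`**: under the same data, `2^k ∤ z(y)` already (the model's «exponent 0»: `z(y₀)` is a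
unit). [cite: Sprung2012, Thm. 2.2 (p. 1487) and Def. 7.9 (p. 1503)] -/
theorem firstLayerTwistDetectionAtTwo_sharp (W : WeierstrassCurve ℚ) [W.IsElliptic] [W.IsGloballyMinimal]
    (hss : GoodSS W 2) (κ : ZpExtension ℚ 2) (v : HeightOneSpectrum (𝓞 ℚ)) (hv : (2 : 𝓞 ℚ) ∈ v.asIdeal)
    {a : ℤ} {g : Field.absoluteGaloisGroup (v.adicCompletion ℚ)}
    (hg : κ.IsTopGenerator (resGalOfEmb (closureEmb (K := ℚ) (v.adicCompletion ℚ)) g))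
    {cneg : localPoints W (v.adicCompletion ℚ)} {c : ℕ → localPoints W (v.adicCompletion ℚ)}
    (hH : IsHondaSystemAtTwo κ (closureEmb (K := ℚ) (v.adicCompletion ℚ)) W a g cneg c)
    (z : localTowerPointsOfEmb κ (closureEmb (K := ℚ) (v.adicCompletion ℚ)) W →+ ℤ_[2])
    (hz : z ⟨g • c 1, smul_mem_localTowerPointsOfEmb κ (closureEmb (K := ℚ) (v.adicCompletion ℚ)) W g
        (localLayerPointsOfEmb_le_localTowerPointsOfEmb κ (closureEmb (K := ℚ) (v.adicCompletion ℚ)) W 1 (hH.2.1 1))⟩ -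
      z ⟨c 1, localLayerPointsOfEmb_le_localTowerPointsOfEmb κ (closureEmb (K := ℚ) (v.adicCompletion ℚ)) W 1 (hH.2.1 1)⟩
        = -2)
    {y : localPoints W (v.adicCompletion ℚ)}
    (hy : y ∈ localLayerPointsOfEmb κ (closureEmb (K := ℚ) (v.adicCompletion ℚ)) W 1) (hgy : g • y = -y)
    {k : ℕ} (hndiv : ∀ w ∈ localLayerPointsOfEmb κ (closureEmb (K := ℚ) (v.adicCompletion ℚ)) W 1, 2 ^ k • w ≠ y) :
    ¬ (2 : ℤ_[2]) ^ k ∣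
      z ⟨y, localLayerPointsOfEmb_le_localTowerPointsOfEmb κ (closureEmb (K := ℚ) (v.adicCompletion ℚ)) W 1 hy⟩ :=
  not_pow_dvd_apply_of_isHondaSystemAtTwo
    (SignedKatoOffTwo.SignedIntersection.noTwoTorsion_localTowerPointsOfEmb_adicCompletion W hss κ v hv _)
    hg hH z hz hy hgy hndiv

end Rat

end OddBlindLocal

end Summit.BirchSwinnertonDyer.BirchSwinnertonDyer.Theorems

end
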